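import Mathlib.LinearAlgebra.Matrix.Rank
import Mathlib.LinearAlgebra.FiniteDimensional.Lemmas
import Literature.NumberTheory.Transcendental.AxSchanuel
import Literature.NumberTheory.Transcendental.AxSchanuelLieDerivative
import Literature.NumberTheory.Transcendental.RosenlichtDifferentials
import HarnessLib

/-!
# Ax's theorem (Ax–Schanuel, differential form) from Rosenlicht's Prop. 4

Trunk T-TRANSCEND (`Literature/NumberTheory/Transcendental`). This file DISCHARGES the named fact
`Literature.NumberTheory.Transcendental.ax_schanuel` (`AxSchanuel.lean`; Ax 1971, Thm. 3, finite families of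
derivations, with the rank term) *relative to* the single named fact
`Literature.NumberTheory.Transcendental.Rosenlicht.Rosenlicht1976_prop4` (`RosenlichtDifferentials.lean`; Rosenlicht 1976, Prop. 4,
of which only the direction (⇒) is used): `ax_schanuel_of_rosenlicht`.

The proof is Rosenlicht's proof of his Thm. 1 (Pacific J. Math. 65 (1976), pp. 488–489: "a slight
generalization of the main result Theorem 4 of [Ax]"), run inside `Ω[K⁄C]` and combined with the
rank–nullity count that produces Ax's rank term (Ax 1971, proof of Thm. 3; Kirby 2010, Thm. 5.1):

1. (`Rosenlicht`, Props. 2, 5) the forms `θᵢ = dzᵢ/zᵢ - dyᵢ ∈ Ω[K⁄C]` are killed by the Lie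
   derivative of every `Dⱼ` (`AxSchanuelLieDerivative.lean`, `lieDeriv_dlog_sub_eq_zero`);
2. (Prop. 6, the Wronskian lemma, ibid.) if the `θᵢ` were `K`-linearly dependent they would be
   `C`-linearly dependent; rewriting a `C`-relation over a `ℚ`-basis of its coefficients turns it
   into `Σ_l c_l dw_l/w_l + dv = 0` with `c_l ∈ C` `ℚ`-linearly independent and `w_l` power
   products of the `zᵢ` (Rosenlicht, proof of the Corollary to Thm. 1), so by **Prop. 4** the
   `w_l` are algebraic over `C`, hence constants (`derivation_eq_zero_of_isAlgebraic`), i.e. the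
   integer combinations `Σᵢ μ_{il} yᵢ` are constants — contradicting the `ℚ`-linear independence
   of `ȳ` modulo `C` (`linearIndependent_dlog_sub_D`);
3. with `V = span_K {dyᵢ, dzᵢ} ⊆ Ω[K⁄C]` and `Φ = (Dⱼ*)ⱼ : V → Kᵐ` (the `Dⱼ` are `C`-derivations,
   so factor through `d`), `θᵢ ∈ ker Φ` and `Φ(dyᵢ) = (Dⱼ yᵢ)ⱼ`, so
   `n + rank (Dⱼ yᵢ) ≤ dim ker Φ + dim im Φ = dim V ≤ trdeg_C C[ȳ, z̄]`
   (`finrank_span_le_trdeg_adjoin`, Rosenlicht Prop. 3) (`ax_schanuel_of_field`);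
4. finally the constants `C = ⋂ ker Dⱼ` of `AxSchanuel.lean` (a subring closed under inverses)
   are given their field structure and the `Dⱼ` are `C`-linear (`ax_schanuel_of_rosenlicht`).

After this file, `ax_schanuel` — and with it Kirby's Thm. 1.2 for `ℂ_exp`
(`KirbyWeakSchanuelProofs.lean`) — rests on exactly two named facts: Rosenlicht 1976 Prop. 4 (⇒)
and Kirby 2010 Prop. 7.1 (`Kirby2010_dcl_subset_ecl`).

## References

* J. Ax, *On Schanuel's conjectures*, Ann. of Math. 93 (1971), 252–268, Thm. 3.
* M. Rosenlicht, *On Liouville's theory of elementary functions*, Pacific J. Math. 65 (1976),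
  485–492, Props. 2–6, Thm. 1 and its Corollary (pp. 486–489).
* J. Kirby, *Exponential algebraicity in exponential fields*, Bull. Lond. Math. Soc. 42 (2010),
  879–890, Thm. 5.1 (Ax's theorem as used there).
-/

noncomputable section

open KaehlerDifferential

namespace Literature.NumberTheory.Transcendental

/-! ### Clearing denominators -/

/-- An element of the `ℚ`-span of a family has a positive integer multiple in its `ℤ`-span
(clearing denominators). [folklore] -/
theorem exists_nsmul_mem_span_int' {κ M : Type*} [AddCommGroup M] [Module ℚ M] (v : κ → M)
    {a : M} (ha : a ∈ Submodule.span ℚ (Set.range v)) :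
    ∃ N : ℕ, N ≠ 0 ∧ (N : ℤ) • a ∈ Submodule.span ℤ (Set.range v) := by
  induction ha using Submodule.span_induction with
  | mem x hx => exact ⟨1, one_ne_zero, by simpa using Submodule.subset_span hx⟩
  | zero => exact ⟨1, one_ne_zero, by simp⟩
  | add x y _ _ hx hy =>
    obtain ⟨N₁, hN₁, h₁⟩ := hx
    obtain ⟨N₂, hN₂, h₂⟩ := hy
    refine ⟨N₁ * N₂, mul_ne_zero hN₁ hN₂, ?_⟩
    rw [smul_add]
    refine Submodule.add_mem _ ?_ ?_
    · rw [Nat.cast_mul, mul_comm, mul_smul]; exact Submodule.smul_mem _ _ h₁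
    · rw [Nat.cast_mul, mul_smul]; exact Submodule.smul_mem _ _ h₂
  | smul q x _ hx =>
    obtain ⟨N, hN, h⟩ := hx
    refine ⟨q.den * N, mul_ne_zero q.den_nz hN, ?_⟩
    have : ((q.den * N : ℕ) : ℤ) • q • x = q.num • ((N : ℤ) • x) := by
      rw [← Int.cast_smul_eq_zsmul ℚ ((q.den * N : ℕ) : ℤ) (q • x), ← Int.cast_smul_eq_zsmul ℚ q.num,
        ← Int.cast_smul_eq_zsmul ℚ (N : ℤ) x, smul_smul, smul_smul]
      congr 1
      push_cast
      rw [mul_right_comm, Rat.den_mul_eq_num]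
    rw [this]
    exact Submodule.smul_mem _ _ h

/-- Common denominators: finitely many elements of the `ℚ`-span of a family have a common positive
integer multiple in its `ℤ`-span. [folklore] -/
theorem exists_common_nsmul_mem_span_int {ι κ M : Type*} [Fintype ι] [AddCommGroup M] [Module ℚ M]
    (v : κ → M) (a : ι → M) (ha : ∀ i, a i ∈ Submodule.span ℚ (Set.range v)) :
    ∃ N : ℕ, N ≠ 0 ∧ ∀ i, (N : ℤ) • a i ∈ Submodule.span ℤ (Set.range v) := by
  classical
  choose N hN hmem using fun i => exists_nsmul_mem_span_int' v (ha i)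
  refine ⟨∏ i, N i, Finset.prod_ne_zero_iff.mpr fun i _ => hN i, fun i => ?_⟩
  rw [← Finset.prod_erase_mul _ _ (Finset.mem_univ i), Nat.cast_mul, mul_smul]
  exact Submodule.smul_mem _ _ (hmem i)

/-! ### Logarithmic derivatives of power products -/

/-- The logarithmic derivative of a power product: `δ(Π uᵢ^{mᵢ})/Π uᵢ^{mᵢ} = Σ mᵢ δuᵢ/uᵢ`
(read off from `dlog (Π uᵢ^{mᵢ}) = Σ mᵢ dlog uᵢ` in `Ω[K⁄R]` by pairing with `δ`). [folklore] -/
theorem inv_mul_derivation_prod_zpow {R K : Type*} [CommRing R] [Field K] [Algebra R K]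
    (δ : Derivation R K K) {ι : Type*} (s : Finset ι) (u : ι → K) (hu : ∀ i ∈ s, u i ≠ 0)
    (m : ι → ℤ) :
    (∏ i ∈ s, u i ^ m i)⁻¹ * δ (∏ i ∈ s, u i ^ m i) = ∑ i ∈ s, (m i : K) * ((u i)⁻¹ * δ (u i)) := by
  have h := congrArg δ.liftKaehlerDifferential (Rosenlicht.dlog_prod_zpow (R := R) s u hu m)
  rw [Rosenlicht.liftKaehlerDifferential_dlog, map_sum] at h
  rw [h]
  refine Finset.sum_congr rfl fun i _ => ?_
  rw [map_zsmul, Rosenlicht.liftKaehlerDifferential_dlog, zsmul_eq_mul]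

/-! ### Step 2: the forms `dzᵢ/zᵢ - dyᵢ` are `K`-linearly independent -/

section Field

variable {k K : Type} [Field k] [CharZero k] [Field K] [CharZero K] [Algebra k K] {m n : ℕ}

/-- **Independence of the logarithmic forms** (Rosenlicht 1976, proof of Thm. 1 and of its
Corollary, with Prop. 4 as input; = the heart of Ax 1971, Thm. 3). Let `k ⊆ K` be fields of
characteristic zero and `D₁, …, D_m` `k`-derivations of `K` whose common constants are exactly
`k`; let `zᵢ ≠ 0`, `Dⱼ zᵢ = zᵢ Dⱼ yᵢ`, and suppose no non-trivial integer combination `Σ qᵢ yᵢ` is a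
constant. Then, granted Rosenlicht's Prop. 4, the forms `zᵢ⁻¹ dzᵢ - dyᵢ ∈ Ω[K⁄k]` are linearly
independent over `K`. Proof: they are killed by every Lie derivative `D¹ⱼ` (Props. 2, 5); by the
Wronskian lemma (Prop. 6) a `K`-relation yields a relation with constant coefficients `bᵢ ∈ k`,
one of them `1`; over a `ℚ`-basis `(c_l)` of `Σ ℚ bᵢ` (after clearing denominators,
`N bᵢ = Σ_l μ_{il} c_l`, `μ_{il} ∈ ℤ`) it becomes `Σ_l c_l dw_l/w_l + dv = 0` with
`w_l = Πᵢ zᵢ^{μ_{il}}`, so by Prop. 4 each `w_l` is algebraic over `k`, hence killed by the `Dⱼ`,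
i.e. `Dⱼ(Σᵢ μ_{il} yᵢ) = Dⱼ w_l / w_l = 0`; so `μ_{·l} = 0` for all `l`, forcing `N b_{i₀} = 0` for the
index with `b_{i₀} = 1` — absurd. [cite: Rosenlicht1976, Thm. 1 and Corollary (proof)] -/
theorem linearIndependent_dlog_sub_D (h4 : Rosenlicht.Rosenlicht1976_prop4)
    (D : Fin m → Derivation k K K)
    (hC : ∀ x : K, (∀ j, D j x = 0) → x ∈ Set.range (algebraMap k K))
    (y z : Fin n → K) (hz : ∀ i, z i ≠ 0) (hexp : ∀ j i, D j (z i) = z i * D j (y i))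
    (hind : ∀ q : Fin n → ℤ, (∀ j, D j (∑ i, (q i : K) * y i) = 0) → q = 0) :
    LinearIndependent K fun i => (z i)⁻¹ • KaehlerDifferential.D k K (z i) -
      KaehlerDifferential.D k K (y i) := by
  classical
  by_contra hdep
  obtain ⟨b, ⟨i₀, hi₀⟩, hbC, hrel⟩ := Rosenlicht.exists_const_relation_lieDeriv D _
    (fun j i => Rosenlicht.lieDeriv_dlog_sub_eq_zero (D j) (hz i) (hexp j i)) hdep
  -- the coefficients come from `k`
  choose b' hb' using fun i => hC (b i) (fun j => hbC j i)
  have hb'₀ : b' i₀ = 1 := (algebraMap k K).injective (by rw [hb', hi₀, map_one])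
  -- a `ℚ`-basis of their span, and integer coordinates after clearing denominators
  obtain ⟨κ, a, ha, hspan, hli⟩ := exists_linearIndependent' ℚ b'
  haveI : Fintype κ := Fintype.ofInjective a ha
  set c : κ → k := b' ∘ a with hc
  have hmem : ∀ i, b' i ∈ Submodule.span ℚ (Set.range c) := fun i => by
    rw [hc, hspan]; exact Submodule.subset_span ⟨i, rfl⟩
  obtain ⟨N, hN, hNmem⟩ := exists_common_nsmul_mem_span_int c b' hmem
  choose μ hμ using fun i => (Submodule.mem_span_range_iff_exists_fun ℤ).mp (hNmem i)
  -- `hμ i : ∑ l, μ i l • c l = (N : ℤ) • b' i`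
  have hNb : ∀ i, (N : K) * b i = ∑ l, (μ i l : K) * algebraMap k K (c l) := fun i => by
    have := congrArg (algebraMap k K) (hμ i)
    rw [map_sum, map_zsmul, hb', zsmul_eq_mul, Int.cast_natCast] at this
    rw [← this]
    exact Finset.sum_congr rfl fun l _ => by rw [map_zsmul, zsmul_eq_mul]
  -- the power products `w_l = Π zᵢ ^ μ_{il}`
  obtain ⟨w, hw⟩ : ∃ w : κ → K, ∀ l, w l = ∏ i, z i ^ μ i l := ⟨_, fun _ => rfl⟩
  have hw0 : ∀ l, w l ≠ 0 := fun l => by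
    rw [hw]; exact Finset.prod_ne_zero_iff.mpr fun i _ => zpow_ne_zero _ (hz i)
  have hdlog : ∀ l, (w l)⁻¹ • KaehlerDifferential.D k K (w l) =
      ∑ i, (μ i l : K) • ((z i)⁻¹ • KaehlerDifferential.D k K (z i)) := fun l => by
    have := Rosenlicht.dlog_prod_zpow (R := k) Finset.univ z (fun i _ => hz i) (fun i => μ i l)
    simp only [Rosenlicht.dlog_def] at this
    rw [hw, this]
    exact Finset.sum_congr rfl fun i _ => by rw [Int.cast_smul_eq_zsmul]
  -- the relation, rewritten: `Σ_l c_l dw_l/w_l + dv = 0` with `v = -Σ N bᵢ yᵢ`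
  set v : K := -∑ i, (N : K) * b i * y i with hv
  have hdv : KaehlerDifferential.D k K v =
      -∑ i, ((N : K) * b i) • KaehlerDifferential.D k K (y i) := by
    rw [hv, map_neg, map_sum]
    congr 1
    refine Finset.sum_congr rfl fun i _ => ?_
    have hconst : KaehlerDifferential.D k K ((N : K) * b i) = 0 := by
      rw [← hb', ← map_natCast (algebraMap k K), ← map_mul, Derivation.map_algebraMap]
    rw [Derivation.leibniz, hconst, smul_zero, add_zero]
  have hsum : (∑ l, algebraMap k K (c l) • (w l)⁻¹ • KaehlerDifferential.D k K (w l)) =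
      ∑ i, ((N : K) * b i) • ((z i)⁻¹ • KaehlerDifferential.D k K (z i)) := by
    calc (∑ l, algebraMap k K (c l) • (w l)⁻¹ • KaehlerDifferential.D k K (w l))
        = ∑ l, ∑ i, (algebraMap k K (c l) * (μ i l : K)) •
            ((z i)⁻¹ • KaehlerDifferential.D k K (z i)) := by
          refine Finset.sum_congr rfl fun l _ => ?_
          rw [hdlog, Finset.smul_sum]
          exact Finset.sum_congr rfl fun i _ => smul_smul _ _ _
      _ = ∑ i, ∑ l, (algebraMap k K (c l) * (μ i l : K)) •
            ((z i)⁻¹ • KaehlerDifferential.D k K (z i)) := Finset.sum_comm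
      _ = ∑ i, ((N : K) * b i) • ((z i)⁻¹ • KaehlerDifferential.D k K (z i)) := by
          refine Finset.sum_congr rfl fun i _ => ?_
          rw [← Finset.sum_smul, hNb, Finset.sum_congr rfl fun l _ =>
            mul_comm (algebraMap k K (c l)) ((μ i l : ℤ) : K)]
  have hrel' : (∑ l, algebraMap k K (c l) • (w l)⁻¹ • KaehlerDifferential.D k K (w l)) +
      KaehlerDifferential.D k K v = 0 := by
    rw [hsum, hdv, ← sub_eq_add_neg, ← Finset.sum_sub_distrib]
    have : ∑ i, (((N : K) * b i) • ((z i)⁻¹ • KaehlerDifferential.D k K (z i)) -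
        ((N : K) * b i) • KaehlerDifferential.D k K (y i)) =
        (N : K) • ∑ i, b i • ((z i)⁻¹ • KaehlerDifferential.D k K (z i) -
          KaehlerDifferential.D k K (y i)) := by
      rw [Finset.smul_sum]
      exact Finset.sum_congr rfl fun i _ => by simp only [smul_sub, smul_smul, mul_assoc]
    rw [this, hrel, smul_zero]
  -- Prop. 4 (after reindexing by `Fin`): the `w_l` are algebraic over `k`
  have halg : ∀ l, IsAlgebraic k (w l) := by
    set e := Fintype.equivFin κ
    have hli' : LinearIndependent ℚ (c ∘ e.symm) := hli.comp _ e.symm.injective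
    have key := h4 k K (Fintype.card κ) (c ∘ e.symm) (w ∘ e.symm) v hli' (fun i => hw0 _)
    have lhs : (∑ i, algebraMap k K ((c ∘ e.symm) i) • ((w ∘ e.symm) i)⁻¹ •
        KaehlerDifferential.D k K ((w ∘ e.symm) i)) =
        ∑ l, algebraMap k K (c l) • (w l)⁻¹ • KaehlerDifferential.D k K (w l) :=
      e.symm.sum_comp (fun l => algebraMap k K (c l) • (w l)⁻¹ • KaehlerDifferential.D k K (w l))
    have := (key.mp (by rw [lhs]; exact hrel')).1
    intro l
    simpa using this (e l)
  -- hence the `Dⱼ` kill the `w_l`: the integer combinations `Σᵢ μ_{il} yᵢ` are constants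
  have hμ0 : ∀ l, (fun i => μ i l) = 0 := by
    intro l
    apply hind
    intro j
    have h1 : D j (w l) = 0 := Rosenlicht.derivation_eq_zero_of_isAlgebraic (D j) (halg l)
    have h2 := inv_mul_derivation_prod_zpow (D j) Finset.univ z (fun i _ => hz i) (fun i => μ i l)
    rw [← hw, h1, mul_zero] at h2
    have h3 : ∀ i, D j ((μ i l : K) * y i) = (μ i l : K) * ((z i)⁻¹ * D j (z i)) := fun i => by
      rw [Derivation.leibniz, Derivation.map_intCast, smul_zero, add_zero, smul_eq_mul, hexp j i,
        ← mul_assoc (z i)⁻¹, inv_mul_cancel₀ (hz i), one_mul]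
    rw [map_sum, Finset.sum_congr rfl fun i _ => h3 i, ← h2]
  -- contradiction at `i₀`
  have h0 : ∑ l, μ i₀ l • c l = 0 :=
    Finset.sum_eq_zero fun l _ => by rw [show μ i₀ l = 0 from congrFun (hμ0 l) i₀, zero_smul]
  have := hμ i₀
  rw [h0, hb'₀, zsmul_one, Int.cast_natCast] at this
  exact hN (Nat.cast_eq_zero.mp this.symm)

/-! ### Step 3: rank–nullity -/

/-- **Ax's theorem over a base field of constants** (Ax 1971, Thm. 3, in the form of Kirby 2010,
Thm. 5.1), from Rosenlicht's Prop. 4: for `k`-derivations `D₁, …, D_m` of `K` with common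
constants exactly `k`, `zᵢ ≠ 0`, `Dⱼ zᵢ = zᵢ Dⱼ yᵢ`, and `ȳ` `ℚ`-linearly independent modulo the
constants, `n + rank (Dⱼ yᵢ)ᵢⱼ ≤ trdeg_k k[ȳ, z̄]`. Proof: with `V = span_K {dyᵢ, dzᵢ} ⊆ Ω[K⁄k]` and
`Φ = (Dⱼ*)ⱼ : V → Kᵐ`, the independent forms `zᵢ⁻¹dzᵢ - dyᵢ` lie in `ker Φ` and the rows
`(Dⱼ yᵢ)ⱼ = Φ(dyᵢ)` lie in `im Φ`, so `n + rank ≤ dim V ≤ trdeg` (`finrank_span_le_trdeg_adjoin`).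
[cite: Ax1971, Thm. 3] -/
theorem ax_schanuel_of_field (h4 : Rosenlicht.Rosenlicht1976_prop4)
    (D : Fin m → Derivation k K K)
    (hC : ∀ x : K, (∀ j, D j x = 0) → x ∈ Set.range (algebraMap k K))
    (y z : Fin n → K) (hz : ∀ i, z i ≠ 0) (hexp : ∀ j i, D j (z i) = z i * D j (y i))
    (hind : ∀ q : Fin n → ℤ, (∀ j, D j (∑ i, (q i : K) * y i) = 0) → q = 0) :
    ((n + (Matrix.of fun i j => D j (y i)).rank : ℕ) : Cardinal) ≤
      Algebra.trdeg k (Algebra.adjoin k (Set.range y ∪ Set.range z)) := by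
  classical
  have hS : (Set.range y ∪ Set.range z).Finite := (Set.finite_range y).union (Set.finite_range z)
  set V : Submodule K (Ω[K⁄k]) :=
    Submodule.span K (KaehlerDifferential.D k K '' (Set.range y ∪ Set.range z)) with hV
  have hyV : ∀ i, KaehlerDifferential.D k K (y i) ∈ V := fun i =>
    Submodule.subset_span ⟨y i, Or.inl ⟨i, rfl⟩, rfl⟩
  have hzV : ∀ i, KaehlerDifferential.D k K (z i) ∈ V := fun i =>
    Submodule.subset_span ⟨z i, Or.inr ⟨i, rfl⟩, rfl⟩
  haveI : FiniteDimensional K V := FiniteDimensional.span_of_finite K (hS.image _)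
  -- the forms `θᵢ` and the map `Φ`
  set θ : Fin n → Ω[K⁄k] := fun i => (z i)⁻¹ • KaehlerDifferential.D k K (z i) -
    KaehlerDifferential.D k K (y i) with hθdef
  have hθV : ∀ i, θ i ∈ V := fun i => V.sub_mem (V.smul_mem _ (hzV i)) (hyV i)
  have hθ : LinearIndependent K θ := linearIndependent_dlog_sub_D h4 D hC y z hz hexp hind
  set Φ : Ω[K⁄k] →ₗ[K] (Fin m → K) := LinearMap.pi fun j => (D j).liftKaehlerDifferential
    with hΦdef
  have hΦD : ∀ x : K, Φ (KaehlerDifferential.D k K x) = fun j => D j x := fun x => by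
    ext j
    simp [hΦdef, Derivation.liftKaehlerDifferential_comp_D]
  have hΦθ : ∀ i, Φ (θ i) = 0 := fun i => by
    ext j
    rw [hθdef, map_sub, map_smul, hΦD, hΦD]
    simp only [Pi.sub_apply, Pi.smul_apply, smul_eq_mul, Pi.zero_apply, hexp j i]
    rw [← mul_assoc, inv_mul_cancel₀ (hz i), one_mul, sub_self]
  set f : V →ₗ[K] (Fin m → K) := Φ.comp V.subtype with hf
  have hrn := LinearMap.finrank_range_add_finrank_ker f
  -- `n ≤ dim ker`
  have h1 : n ≤ Module.finrank K (LinearMap.ker f) := by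
    set θ' : Fin n → V := fun i => ⟨θ i, hθV i⟩ with hθ'
    have hθ'ind : LinearIndependent K θ' := LinearIndependent.of_comp V.subtype (by exact hθ)
    have hle : Submodule.span K (Set.range θ') ≤ LinearMap.ker f := by
      rw [Submodule.span_le]
      rintro _ ⟨i, rfl⟩
      simp only [SetLike.mem_coe, LinearMap.mem_ker, hf, LinearMap.comp_apply,
        Submodule.subtype_apply, hθ']
      exact hΦθ i
    calc n = Fintype.card (Fin n) := (Fintype.card_fin n).symm
      _ = Module.finrank K (Submodule.span K (Set.range θ')) := (finrank_span_eq_card hθ'ind).symm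
      _ ≤ Module.finrank K (LinearMap.ker f) := Submodule.finrank_mono hle
  -- `rank ≤ dim im`
  have h2 : (Matrix.of fun i j => D j (y i)).rank ≤ Module.finrank K (LinearMap.range f) := by
    rw [Matrix.rank_eq_finrank_span_row]
    apply Submodule.finrank_mono
    rw [Submodule.span_le]
    rintro _ ⟨i, rfl⟩
    refine ⟨⟨KaehlerDifferential.D k K (y i), hyV i⟩, ?_⟩
    rw [hf, LinearMap.comp_apply, Submodule.subtype_apply, hΦD]
    rfl
  -- `dim V ≤ trdeg`
  have h3 := Rosenlicht.finrank_span_le_trdeg_adjoin (KaehlerDifferential.D k K)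
    (Set.range y ∪ Set.range z) hS
  calc ((n + (Matrix.of fun i j => D j (y i)).rank : ℕ) : Cardinal)
      ≤ (Module.finrank K V : Cardinal) := by exact_mod_cast (by omega)
    _ ≤ _ := h3

end Field

/-! ### Step 4: the named fact -/

/-- The common constants of a family of derivations of a field form a field. [folklore] -/
theorem isField_constantSubring {K : Type*} [Field K] {ι : Type*} (D : ι → Derivation ℤ K K) :
    IsField (constantSubring D) := by
  refine { exists_pair_ne := ⟨0, 1, zero_ne_one⟩, mul_comm := mul_comm, mul_inv_cancel := ?_ }
  intro a ha
  refine ⟨⟨(a : K)⁻¹, inv_mem_constantSubring a.2⟩, Subtype.ext ?_⟩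
  show (a : K) * (a : K)⁻¹ = 1
  exact mul_inv_cancel₀ fun h => ha (Subtype.ext h)

/-- A derivation of `K` is linear over its constants: the family `D` as `C`-derivations for
`C = constantSubring D` (with any compatible ring structure on `C`). [folklore] -/
def toConstDerivation {K : Type*} [Field K] {ι : Type*} (D : ι → Derivation ℤ K K) (j : ι) :
    Derivation (constantSubring D) K K where
  toFun := D j
  map_add' := map_add (D j)
  map_smul' r x := by
    show D j ((r : K) * x) = (r : K) * D j x
    rw [Derivation.leibniz, r.2 j, smul_zero, add_zero, smul_eq_mul]
  map_one_eq_zero' := (D j).map_one_eq_zero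
  leibniz' a b := (D j).leibniz a b

/-- Unfolding `toConstDerivation`. [folklore] -/
@[simp] theorem toConstDerivation_apply {K : Type*} [Field K] {ι : Type*}
    (D : ι → Derivation ℤ K K) (j : ι) (x : K) : toConstDerivation D j x = D j x :=
  rfl

/-- **Ax's theorem** (`Literature.NumberTheory.Transcendental.ax_schanuel`: Ax 1971, Thm. 3, for finite families of
derivations, with the rank term) **from Rosenlicht 1976, Prop. 4** — the discharge of the named
fact of `AxSchanuel.lean` relative to the named fact `Rosenlicht1976_prop4`: give the constants
`C = ⋂ ker Dⱼ` their field structure, view the `Dⱼ` as `C`-derivations, and apply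
`ax_schanuel_of_field`. [cite: Ax1971, Thm. 3] -/
theorem ax_schanuel_of_rosenlicht (h4 : Rosenlicht.Rosenlicht1976_prop4) : ax_schanuel := by
  intro K _ _ m n D y z hz hexp hind
  classical
  letI : Field (constantSubring D) := (isField_constantSubring D).toField
  haveI : CharZero (constantSubring D) := (algebraMap (constantSubring D) K).charZero
  have hC : ∀ x : K, (∀ j, toConstDerivation D j x = 0) →
      x ∈ Set.range (algebraMap (constantSubring D) K) :=
    fun x hx => ⟨⟨x, fun j => hx j⟩, rfl⟩
  have hind' : ∀ q : Fin n → ℤ, (∀ j, toConstDerivation D j (∑ i, (q i : K) * y i) = 0) → q = 0 :=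
    fun q hq => hind q fun j => hq j
  exact ax_schanuel_of_field h4 (toConstDerivation D) hC y z hz (fun j i => hexp j i) hind'

end Literature.NumberTheory.Transcendental

end
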